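import Summits.QuantumFields.BalabanUV.T4Continuum.Support.NE7K1LinWalkLineBox

/-!
# NE7K1LinWalkLineSeries — row NE7 (node U5), candidate route HOM, path H1L, cell K1-lin(s): THE RANDOM-WALK REPRESENTATION OF THE
# TWO-CUTOFF LINE's PROPAGATOR ITSELF — `(twoCutoffLine s)⁻¹ = Σ_k [G₀(s)·R(s)^k]₁₁` (the coarse block of the ψ-rescaled expansion,
# term by term), convergent for EVERY `s ∈ [0,1]` once `3^{d+1}τ♮(d,L,M,a) < 1`

Lineage `b2b-balaban-t4-ne7-p2` (CRUX PROVER NE7 #2), generation 69; series (RW) file 17 (a corollary file), over `NE7K1LinWalkLineWalk`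
(file 14: `hasSum_extLine_walk` for `(𝒫♮(s))⁻¹`), `NE7K1LinWalkLineBox` (file 15: the concrete box) and `NE7K1LinWalkLine.extLine_inv_inl_inl`
(g68: the coarse inverse block IS the line's propagator).  The desk's KILL (xx-L) [L4] reads «HasSum + decay BY NAME through file 3 for
`𝒫♮(s)`, then RESTRICTED to the coarse block by `extLine_inv_inl_inl` ⇒ a statement about `(twoCutoffLine s)⁻¹`»; file 14 restricted the
DECAY, this file restricts the SERIES:

* `hasSum_toBlocks₁₁` (coarse blocks of a convergent matrix series — `Matrix.toBlocks₁₁` is additive and continuous),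
  `toBlocks₁₁_inv_extLine` (`[(𝒫♮(s))⁻¹]₁₁ = (twoCutoffLine s)⁻¹`);
* **`hasSum_twoCutoffLine_walk`** — under file 14's hypotheses (`R′.image (blk L) = Π[0,(2K_μ+1)Mn)`, `3^{d+1}τ♮ < 1`):
  `HasSum (k ↦ [G₀(s)R(s)^k]₁₁) (twoCutoffLine s)⁻¹` — B4 (2.12) *"G = Σ_n G₀Rⁿ"* FOR THE LINE's PROPAGATOR, every `s ∈ [0,1]`, every mesh;
* **`hasSum_twoCutoffLine_walk_box`** — the same on the concrete fine box `Π[0, nL(2K_μ+1)M)` (no hypothesis beyond `n ≥ 1`, `M ≥ 3`,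
  `a > 0`, `s ∈ [0,1]`, `3^{d+1}τ♮ < 1`).

HONEST FRAMING: [folklore] a continuous additive map applied to a convergent series; Gaussian `A = 0` level, U = 1, one scale, boxes, crude
constants; nothing of Bałaban's asserted; no `sorry`.  Census only; NO letter ∕ tag ∕ size of NE7 moves; NE7 NOT PRINTED ∕ NOT PROVED; spine 0∕9;
FIXED FINITE T⁴, rung (B)+1; NOT infinite volume, NOT mass gap, NOT Clay.  HONEST DEPENDENCY: continuum YM on T⁴ ⇐ BetaPertH ∧ nine spine estimates
(0/9 proved); BetaPertH ⇐ (D1) ∧ (D4) ∧ CAP+tail; G-an2-4 gates asym, D1 and NE2/3/4.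
-/

noncomputable section

open Finset Matrix
open scoped Matrix.Norms.L2Operator

namespace Summit.QuantumFields.BalabanUV.T4Continuum.NE7K1LinWalkLineSeries

open Literature.MathematicalPhysics.QuantumFieldTheory.Balaban1983to89
open Literature.MathematicalPhysics.QuantumFieldTheory.Balaban1983to89.B4Reflection242
open Literature.MathematicalPhysics.QuantumFieldTheory.Balaban1983to89.B4BoxCov237
open Literature.MathematicalPhysics.QuantumFieldTheory.Balaban1983to89.B4Lower18
open NE7K1LinBlockCoords NE7K1LinSchurLineU1 NE7K1LinWalkParametrix NE7K1LinWalkCubes NE7K1LinWalkBox NE7K1LinWalkFineOp NE7K1LinWalkLine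
  NE7K1LinWalkLineWalk NE7K1LinWalkLineBox

variable {d : ℕ}

/-! ### §1 The coarse-block map commutes with convergent sums -/

section Blocks

variable {ιc ιf : Type*}

/-- **COARSE BLOCKS OF A CONVERGENT MATRIX SERIES**: `HasSum f A ⇒ HasSum (k ↦ (f k)₁₁) A₁₁` (the block map `Matrix.toBlocks₁₁` is additive
and continuous — entrywise a coordinate projection; the `ℓ²`-operator-norm topology IS the product topology). [folklore] -/
theorem hasSum_toBlocks₁₁ {f : ℕ → Matrix (ιc ⊕ ιf) (ιc ⊕ ιf) ℝ} {A : Matrix (ιc ⊕ ιf) (ιc ⊕ ιf) ℝ} (h : HasSum f A) :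
    HasSum (fun k => (f k).toBlocks₁₁) A.toBlocks₁₁ :=
  h.map (AddMonoidHom.mk' (fun B : Matrix (ιc ⊕ ιf) (ιc ⊕ ιf) ℝ => B.toBlocks₁₁) fun _ _ => rfl)
    (continuous_matrix fun i j => continuous_id.matrix_elem (Sum.inl i) (Sum.inl j))

end Blocks

/-! ### §2 The series for the line's propagator -/

section Line

variable {n L M : ℕ} [NeZero L] {R' : Finset (Fin (d + 1) → ℤ)} (K : Fin (d + 1) → ℕ) (hn : 1 ≤ n) (hM : 3 ≤ M)
  (hR' : IsBlockUnion (n * L) R') (hbox : R'.image (blk L) = boxDom fun μ => (2 * K μ + 1) * (M * n)) {a : ℝ} (ha : 0 < a)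
  {s : ℝ} (hs0 : 0 ≤ s) (hs1 : s ≤ 1)

include hn ha hs0 in
/-- **THE COARSE BLOCK OF `(𝒫♮(s))⁻¹` IS `(twoCutoffLine s)⁻¹`** as matrices (`NE7K1LinWalkLine.extLine_inv_inl_inl` entrywise). [folklore] -/
theorem toBlocks₁₁_inv_extLine :
    ((extLine (isBlockUnion_fine hR') n a s)⁻¹).toBlocks₁₁ = (twoCutoffLine (isBlockUnion_fine hR') n a s)⁻¹ := by
  ext x y
  rw [toBlocks₁₁, of_apply, extLine_inv_inl_inl hn hR' ha hs0 x y]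

include hn hM hR' hbox ha hs0 hs1 in
/-- **THE RANDOM-WALK REPRESENTATION OF THE TWO-CUTOFF LINE's PROPAGATOR**: under file 14's hypotheses and `3^{d+1}τ♮ < 1`,
`HasSum (k ↦ [G₀(s)·R(s)^k]₁₁) (twoCutoffLine s)⁻¹` — the coarse block of every term of the ψ-rescaled expansion, summed, IS the line's
propagator; every `s ∈ [0,1]`, every mesh, the same threshold. [cite: Balaban1983RegularityDecay, (2.12) p.577, case A = 0, shape] [folklore] -/
theorem hasSum_twoCutoffLine_walk (hsmall : (3 : ℝ) ^ (d + 1) * lineTau d L M a < 1) :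
    HasSum (fun k : ℕ =>
      ((∑ J : Lab K, aPiece (extLine (isBlockUnion_fine hR') n a s) (fun c : Idx L R' => cut (M * n) J.1 (site c).1)
          (fun c => if c ∈ univ.filter (fun c : Idx L R' => site c ∈ region (R'.image (blk L)) (M * n) n J.1) then (1 : ℝ) else 0)
          (univ.filter fun c : Idx L R' => site c ∈ region (R'.image (blk L)) (M * n) n J.1)) *
        (∑ J : Lab K, bPiece (extLine (isBlockUnion_fine hR') n a s) (fun c : Idx L R' => cut (M * n) J.1 (site c).1)
          (fun c => if c ∈ univ.filter (fun c : Idx L R' => site c ∈ region (R'.image (blk L)) (M * n) n J.1) then (1 : ℝ) else 0)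
          (univ.filter fun c : Idx L R' => site c ∈ region (R'.image (blk L)) (M * n) n J.1)) ^ k).toBlocks₁₁)
      (twoCutoffLine (isBlockUnion_fine hR') n a s)⁻¹ := by
  rw [← toBlocks₁₁_inv_extLine hn hR' ha hs0]
  exact hasSum_toBlocks₁₁ (hasSum_extLine_walk K hn hM hR' hbox ha hs0 hs1 hsmall)

end Line

section Box

variable {n L M : ℕ} [NeZero L] (K : Fin (d + 1) → ℕ) (hn : 1 ≤ n) (hM : 3 ≤ M) {a : ℝ} (ha : 0 < a) {s : ℝ} (hs0 : 0 ≤ s) (hs1 : s ≤ 1)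

include hM ha hs0 hs1 in
/-- **THE SAME ON THE CONCRETE FINE BOX** `Π_μ[0, nL(2K_μ+1)M)`: `HasSum (k ↦ [G₀(s)·R(s)^k]₁₁) (twoCutoffLine s)⁻¹` for `n ≥ 1`, `M ≥ 3`,
`a > 0`, every `s ∈ [0,1]`, `3^{d+1}τ♮(d,L,M,a) < 1`. [folklore] -/
theorem hasSum_twoCutoffLine_walk_box (hsmall : (3 : ℝ) ^ (d + 1) * lineTau d L M a < 1) :
    HasSum (fun k : ℕ =>
      ((∑ J : Lab K, aPiece (extLine (isBlockUnion_fine (isBlockUnion_lineBox K hn M)) n a s)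
          (fun c : Idx L (boxDom fun μ => n * L * ((2 * K μ + 1) * M)) => cut (M * n) J.1 (site c).1)
          (fun c => if c ∈ univ.filter (fun c : Idx L (boxDom fun μ => n * L * ((2 * K μ + 1) * M)) =>
            site c ∈ region ((boxDom fun μ => n * L * ((2 * K μ + 1) * M)).image (blk L)) (M * n) n J.1) then (1 : ℝ) else 0)
          (univ.filter fun c : Idx L (boxDom fun μ => n * L * ((2 * K μ + 1) * M)) =>
            site c ∈ region ((boxDom fun μ => n * L * ((2 * K μ + 1) * M)).image (blk L)) (M * n) n J.1)) *
        (∑ J : Lab K, bPiece (extLine (isBlockUnion_fine (isBlockUnion_lineBox K hn M)) n a s)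
          (fun c : Idx L (boxDom fun μ => n * L * ((2 * K μ + 1) * M)) => cut (M * n) J.1 (site c).1)
          (fun c => if c ∈ univ.filter (fun c : Idx L (boxDom fun μ => n * L * ((2 * K μ + 1) * M)) =>
            site c ∈ region ((boxDom fun μ => n * L * ((2 * K μ + 1) * M)).image (blk L)) (M * n) n J.1) then (1 : ℝ) else 0)
          (univ.filter fun c : Idx L (boxDom fun μ => n * L * ((2 * K μ + 1) * M)) =>
            site c ∈ region ((boxDom fun μ => n * L * ((2 * K μ + 1) * M)).image (blk L)) (M * n) n J.1)) ^ k).toBlocks₁₁)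
      (twoCutoffLine (isBlockUnion_fine (isBlockUnion_lineBox K hn M)) n a s)⁻¹ :=
  hasSum_twoCutoffLine_walk K hn hM (isBlockUnion_lineBox K hn M) (image_blk_lineBox K n M) ha hs0 hs1 hsmall

end Box

end Summit.QuantumFields.BalabanUV.T4Continuum.NE7K1LinWalkLineSeries

end
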